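import Summits.QuantumFields.YangMills.Theses.CovariantDischarge
import Summits.QuantumFields.YangMills.Theses.FirstExitWindow

/-!
# CovariantDischarge — the residual `DeepWindowTailL` is an instantiation of `FirstExitWindowTailL`

Free lemma recorded at the critic's request (idea-crit-5 VERDICT #131, price (4)): the deep residual of route
CovariantDischarge (item stmt-QuantumFields-22892) is implied VERBATIM by the first-exit window tail
`FirstExitWindow.FirstExitWindowTailL` (item stmt-QuantumFields-26243) — one instantiation, the extra range
hypothesis `K < N₁ * j` is simply dropped. This makes the residual's membership of the averaged-tail organ a tree
fact. No crux, rung or summit is proved here.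
-/

namespace Summit.QuantumFields.YangMills.Theorems

open Summit.QuantumFields.YangMills.Theses

/-- `FirstExitWindowTailL → CovariantDischarge.DeepWindowTailL` (instantiation; the range hypothesis is unused).
[folklore] -/
theorem covariantDischarge_deepWindowTailL_of_firstExitWindowTailL
    (h : FirstExitWindow.FirstExitWindowTailL) : CovariantDischarge.DeepWindowTailL := by
  intro L N₁ _hN₁ b₀ p₀ b₂ hb₀ hp₀ hb₂
  obtain ⟨γ₁, C, c, N, hγ₁, hγ₁1, hc, hmain⟩ := h L b₀ p₀ b₂ hb₀ hp₀ hb₂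
  exact ⟨γ₁, C, c, N, hγ₁, hγ₁1, hc,
    fun F γ hFL hγ hγγ₁ K j hj hjK _hKN p => hmain F γ hFL hγ hγγ₁ K j hj hjK p⟩

end Summit.QuantumFields.YangMills.Theorems
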